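import Literature.Computability.QuantumComplexity.SU2ChordGeometry
import Literature.Computability.QuantumComplexity.SU2DensityCriterion
import Mathlib.Analysis.SpecialFunctions.Trigonometric.Bounds
import HarnessLib

/-!
# The maximal torus of `SU(2)`: angles versus chords, conjugation to the torus

Topic `Literature/Computability/QuantumComplexity`; sequel of `SU2ChordGeometry.lean`, proof
infrastructure for the exact braid compiler of the Jones-hardness reduction (Aharonov–Arad 2011
§3.3). Every `E ∈ SU(2)` is `R · D(ψ) · R⁻¹` with `D(ψ) = diag(e^{iψ}, e^{-iψ})` and an ANGLE
`ψ ∈ [0, π]`; the compiler never computes angles (it compares traces), but its analysis does: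

* `torus ψ ∈ SU(2)`, a one-parameter group (`torus_add`, `torus_zero`, `torus_nsmul`), with
  `tr D(ψ) = 2 cos ψ` (`trace_torus_re`);
* chords versus angles: `‖1 - D(ψ)‖² = 2 - 2cos ψ` (`norm_one_sub_torus_sq`), hence
  `‖1 - D(ψ)‖ ≤ |ψ|` and, for `|ψ| ≤ π`, `‖1 - D(ψ)‖ ≥ (2/π)|ψ|` (`norm_one_sub_torus_le`,
  `mul_abs_le_norm_one_sub_torus`); `‖D(ψ) - D(ψ')‖ ≤ |ψ - ψ'|`;
* `exists_conj_torus` — every `E ∈ SU(2)` is `R D(ψ) R⁻¹` with `0 ≤ ψ ≤ π` (diagonalisation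
  `exists_conj_eq_diagonal` plus the signed swap to make the angle non-negative), and then
  `‖1 - E‖² = 2 - 2cos ψ`;
* `norm_mul_sub_mul_le_two_mul` — `‖XP - PX‖ ≤ 2 ‖X - 1‖ ‖P - 1‖` (elements near `1` almost
  commute), the estimate that lets an APPROXIMATE conjugator move a small rotation's axis.

## References

* D. Aharonov, I. Arad, New J. Phys. 13 (2011) 035019, §3.3 [AharonovArad2011].
* C. M. Dawson, M. A. Nielsen, QIC 6 (2006), §4.1 [DawsonNielsen2006].
-/

noncomputable section

open scoped Matrix.Norms.L2Operator

namespace Literature.Computability.QuantumComplexity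

open Matrix Complex

/-! ### Almost-commutation near the identity -/

section General

variable {n : Type*} [Fintype n] [DecidableEq n]

/-- **Elements near `1` almost commute**: `‖XP - PX‖ ≤ 2 ‖X - 1‖ ‖P - 1‖`
(`XP - PX = (X-1)(P-1) - (P-1)(X-1)`). [folklore] -/
theorem norm_mul_sub_mul_le_two_mul (X P : Matrix n n ℂ) : ‖X * P - P * X‖ ≤ 2 * ‖X - 1‖ * ‖P - 1‖ := by
  have e : X * P - P * X = (X - 1) * (P - 1) - (P - 1) * (X - 1) := by noncomm_ring
  rw [e]
  calc ‖(X - 1) * (P - 1) - (P - 1) * (X - 1)‖ ≤ ‖(X - 1) * (P - 1)‖ + ‖(P - 1) * (X - 1)‖ := norm_sub_le _ _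
    _ ≤ ‖X - 1‖ * ‖P - 1‖ + ‖P - 1‖ * ‖X - 1‖ := add_le_add (Matrix.l2_opNorm_mul _ _) (Matrix.l2_opNorm_mul _ _)
    _ = 2 * ‖X - 1‖ * ‖P - 1‖ := by ring

/-- **An approximate conjugator moves a small element little**: `‖X - P X P†‖ ≤ 2 ‖X - 1‖ ‖P - 1‖` for
unitary `P`. [folklore] -/
theorem norm_sub_conj_le {X P : Matrix n n ℂ} (hP : P ∈ Matrix.unitaryGroup n ℂ) :
    ‖X - P * X * star P‖ ≤ 2 * ‖X - 1‖ * ‖P - 1‖ := by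
  have hPs : P * star P = 1 := Unitary.mul_star_self_of_mem hP
  have e : X - P * X * star P = (X * P - P * X) * star P := by
    rw [sub_mul, Matrix.mul_assoc X, hPs, Matrix.mul_one]
  rw [e]
  calc ‖(X * P - P * X) * star P‖ ≤ ‖X * P - P * X‖ * ‖star P‖ := Matrix.l2_opNorm_mul _ _
    _ ≤ ‖X * P - P * X‖ * 1 :=
        mul_le_mul_of_nonneg_left (SolovayKitaev.norm_star_le_one_of_mem_unitaryGroup hP) (norm_nonneg _)
    _ ≤ 2 * ‖X - 1‖ * ‖P - 1‖ := by rw [mul_one]; exact norm_mul_sub_mul_le_two_mul X P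

end General

/-! ### The torus -/

section Torus

/-- The diagonal matrix `D(ψ) = diag(e^{iψ}, e^{-iψ})` is special unitary. [folklore] -/
theorem diagMatrix_neg_mem (ψ : ℝ) : diagMatrix ψ (-ψ) ∈ Matrix.specialUnitaryGroup (Fin 2) ℂ := by
  rw [Matrix.mem_specialUnitaryGroup_iff]
  refine ⟨diagMatrix_mem ψ (-ψ), ?_⟩
  unfold diagMatrix
  rw [Matrix.det_fin_two_of, ← Complex.exp_add]
  convert Complex.exp_zero using 2
  push_cast
  ring

/-- **The torus** `D(ψ) = diag(e^{iψ}, e^{-iψ}) ∈ SU(2)`. [folklore] -/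
def torus (ψ : ℝ) : Matrix.specialUnitaryGroup (Fin 2) ℂ := ⟨diagMatrix ψ (-ψ), diagMatrix_neg_mem ψ⟩

/-- Underlying matrix. [folklore] -/
@[simp] theorem coe_torus (ψ : ℝ) : ((torus ψ : Matrix.specialUnitaryGroup (Fin 2) ℂ) : Matrix (Fin 2) (Fin 2) ℂ) =
    diagMatrix ψ (-ψ) := rfl

/-- `D` is a one-parameter group. [folklore] -/
theorem torus_add (a b : ℝ) : torus (a + b) = torus a * torus b :=
  Subtype.ext (by
    rw [coe_torus, Submonoid.coe_mul, coe_torus, coe_torus, neg_add]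
    exact diagMatrix_add a (-a) b (-b))

/-- `D(0) = 1`. [folklore] -/
theorem torus_zero : torus 0 = 1 := Subtype.ext (by rw [coe_torus, neg_zero, diagMatrix_zero]; rfl)

/-- `D(jψ) = D(ψ)^j`. [folklore] -/
theorem torus_nsmul (j : ℕ) (ψ : ℝ) : torus (j * ψ) = torus ψ ^ j := by
  induction j with
  | zero => simp [torus_zero]
  | succ j ih => rw [Nat.cast_succ, add_mul, one_mul, torus_add, ih, pow_succ]

/-- `D(-ψ) = D(ψ)⁻¹`. [folklore] -/
theorem torus_neg (ψ : ℝ) : torus (-ψ) = (torus ψ)⁻¹ :=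
  eq_inv_of_mul_eq_one_left (by rw [← torus_add, neg_add_cancel, torus_zero])

/-- `tr D(ψ) = 2cos ψ`. [folklore] -/
theorem trace_torus (ψ : ℝ) :
    ((torus ψ : Matrix.specialUnitaryGroup (Fin 2) ℂ) : Matrix (Fin 2) (Fin 2) ℂ).trace = ((2 * Real.cos ψ : ℝ) : ℂ) := by
  rw [coe_torus]
  unfold diagMatrix
  rw [Matrix.trace_fin_two_of]
  apply Complex.ext
  · simp [Complex.exp_re, Real.cos_neg, Complex.cos_ofReal_re]; ring
  · simp [Complex.exp_im, Real.sin_neg]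

/-- `Re tr D(ψ) = 2cos ψ`. [folklore] -/
theorem trace_torus_re (ψ : ℝ) :
    (((torus ψ : Matrix.specialUnitaryGroup (Fin 2) ℂ) : Matrix (Fin 2) (Fin 2) ℂ).trace).re = 2 * Real.cos ψ := by
  rw [trace_torus, Complex.ofReal_re]

/-- **`‖1 - D(ψ)‖² = 2 - 2cos ψ`.** [folklore] -/
theorem norm_one_sub_torus_sq (ψ : ℝ) :
    ‖(1 : Matrix (Fin 2) (Fin 2) ℂ) - ((torus ψ : Matrix.specialUnitaryGroup (Fin 2) ℂ) : Matrix (Fin 2) (Fin 2) ℂ)‖ ^ 2 =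
      2 - 2 * Real.cos ψ := by
  rw [norm_one_sub_coe_sq, trace_torus_re]

/-- **Chord ≤ angle**: `‖1 - D(ψ)‖ ≤ |ψ|` (`2 - 2cos ψ ≤ ψ²`). [folklore] -/
theorem norm_one_sub_torus_le (ψ : ℝ) :
    ‖(1 : Matrix (Fin 2) (Fin 2) ℂ) - ((torus ψ : Matrix.specialUnitaryGroup (Fin 2) ℂ) : Matrix (Fin 2) (Fin 2) ℂ)‖ ≤ |ψ| := by
  have h := norm_one_sub_torus_sq ψ
  have hc := Real.one_sub_sq_div_two_le_cos (x := ψ)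
  have hn := norm_nonneg ((1 : Matrix (Fin 2) (Fin 2) ℂ) - ((torus ψ : Matrix.specialUnitaryGroup (Fin 2) ℂ) : Matrix (Fin 2) (Fin 2) ℂ))
  refine (pow_le_pow_iff_left₀ hn (abs_nonneg ψ) two_ne_zero).1 ?_
  rw [h, sq_abs]
  linarith

/-- **Angle ≤ (π/2)·chord**: `(2/π)|ψ| ≤ ‖1 - D(ψ)‖` for `|ψ| ≤ π` (`cos ψ ≤ 1 - (2/π²)ψ²`). [folklore] -/
theorem mul_abs_le_norm_one_sub_torus {ψ : ℝ} (hψ : |ψ| ≤ Real.pi) :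
    2 / Real.pi * |ψ| ≤ ‖(1 : Matrix (Fin 2) (Fin 2) ℂ) - ((torus ψ : Matrix.specialUnitaryGroup (Fin 2) ℂ) : Matrix (Fin 2) (Fin 2) ℂ)‖ := by
  have h := norm_one_sub_torus_sq ψ
  have hc := Real.cos_le_one_sub_mul_cos_sq hψ
  have hn := norm_nonneg ((1 : Matrix (Fin 2) (Fin 2) ℂ) - ((torus ψ : Matrix.specialUnitaryGroup (Fin 2) ℂ) : Matrix (Fin 2) (Fin 2) ℂ))
  have hpi := Real.pi_pos
  have h0 : 0 ≤ 2 / Real.pi * |ψ| := by positivity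
  refine (pow_le_pow_iff_left₀ h0 hn two_ne_zero).1 ?_
  rw [h, mul_pow, sq_abs]
  have e : (2 / Real.pi) ^ 2 * ψ ^ 2 = 2 * (2 / Real.pi ^ 2 * ψ ^ 2) := by field_simp
  rw [e]
  linarith

/-- `‖D(ψ) - D(ψ')‖ ≤ |ψ - ψ'|`. [folklore] -/
theorem norm_torus_sub_torus_le (ψ ψ' : ℝ) :
    ‖((torus ψ : Matrix.specialUnitaryGroup (Fin 2) ℂ) : Matrix (Fin 2) (Fin 2) ℂ) -
        ((torus ψ' : Matrix.specialUnitaryGroup (Fin 2) ℂ) : Matrix (Fin 2) (Fin 2) ℂ)‖ ≤ |ψ - ψ'| := by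
  have e : torus ψ' = torus ψ * torus (ψ' - ψ) := by rw [← torus_add]; congr 1; ring
  rw [e, Submonoid.coe_mul, ← Matrix.mul_one ((torus ψ : Matrix.specialUnitaryGroup (Fin 2) ℂ) : Matrix (Fin 2) (Fin 2) ℂ),
    Matrix.mul_assoc, Matrix.one_mul, ← mul_sub, SolovayKitaev.norm_coe_mul, abs_sub_comm]
  exact norm_one_sub_torus_le _

/-- The signed swap as an element of `SU(2)`. [folklore] -/
def swapSU : Matrix.specialUnitaryGroup (Fin 2) ℂ :=
  ⟨swapMatrix, Matrix.mem_specialUnitaryGroup_iff.2 ⟨swapMatrix_mem, by unfold swapMatrix; simp [Matrix.det_fin_two_of]⟩⟩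

/-- **The swap reverses the torus**: `W D(ψ) W⁻¹ = D(-ψ)`. [folklore] -/
theorem swapSU_mul_torus_mul_inv (ψ : ℝ) : swapSU * torus ψ * swapSU⁻¹ = torus (-ψ) := by
  apply Subtype.ext
  rw [Submonoid.coe_mul, Submonoid.coe_mul, SolovayKitaev.coe_inv, coe_torus, coe_torus]
  change swapMatrix * diagMatrix ψ (-ψ) * star swapMatrix = diagMatrix (-ψ) (- -ψ)
  unfold swapMatrix diagMatrix
  rw [star_fin_two, Matrix.mul_fin_two, Matrix.mul_fin_two, neg_neg]
  ext i j
  fin_cases i <;> fin_cases j <;> simp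

/-- The diagonal factor of an `SU(2)` diagonalisation is a torus element: `diag(d₀, d₁)` with
`|d₀| = 1`, `d₀ d₁ = 1` is `D(arg d₀)`. [folklore] -/
theorem diagonal_eq_coe_torus {d : Fin 2 → ℂ} (hd : ‖d 0‖ = 1) (hdet : d 0 * d 1 = 1) :
    diagonal d = ((torus (arg (d 0)) : Matrix.specialUnitaryGroup (Fin 2) ℂ) : Matrix (Fin 2) (Fin 2) ℂ) := by
  rw [coe_torus, Matrix.diagonal_fin_two]
  unfold diagMatrix
  have e0 : cexp ((arg (d 0) : ℂ) * I) = d 0 := exp_arg_mul_I_of_norm_eq_one hd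
  have e1 : cexp (((-arg (d 0) : ℝ) : ℂ) * I) = d 1 := by
    rw [show ((-arg (d 0) : ℝ) : ℂ) * I = -((arg (d 0) : ℂ) * I) by push_cast; ring, Complex.exp_neg, e0]
    exact inv_eq_of_mul_eq_one_right hdet
  rw [e0, e1]

/-- **Conjugation to the torus with a non-negative angle**: every `E ∈ SU(2)` is `R D(ψ) R⁻¹` with
`0 ≤ ψ ≤ π`. [folklore] -/
theorem exists_conj_torus (E : Matrix.specialUnitaryGroup (Fin 2) ℂ) :
    ∃ R : Matrix.specialUnitaryGroup (Fin 2) ℂ, ∃ ψ : ℝ, 0 ≤ ψ ∧ ψ ≤ Real.pi ∧ E = R * torus ψ * R⁻¹ := by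
  obtain ⟨u, D, d, hD, hE⟩ := Literature.MathematicalPhysics.QuantumLattice.exists_conj_eq_diagonal E
  have hDmem := Matrix.mem_specialUnitaryGroup_iff.1 D.2
  have hd : ∀ i, ‖d i‖ = 1 :=
    (Literature.MathematicalPhysics.QuantumLattice.diagonal_mem_unitaryGroup_iff d).1 (hD ▸ hDmem.1)
  have hdet : d 0 * d 1 = 1 := by
    have e := hDmem.2; rw [hD, det_diagonal, Fin.prod_univ_two] at e; exact e
  have hDt : D = torus (arg (d 0)) := Subtype.ext (by rw [hD]; exact diagonal_eq_coe_torus (hd 0) hdet)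
  rcases le_or_gt 0 (arg (d 0)) with h0 | h0
  · exact ⟨u, arg (d 0), h0, Complex.arg_le_pi _, by rw [hE, hDt]⟩
  · refine ⟨u * swapSU⁻¹, -arg (d 0), by linarith, by linarith [Complex.neg_pi_lt_arg (d 0)], ?_⟩
    rw [hE, hDt, ← swapSU_mul_torus_mul_inv]
    group

/-- The trace is a class function. [folklore] -/
theorem trace_conj (R X : Matrix.specialUnitaryGroup (Fin 2) ℂ) :
    (((R * X * R⁻¹ : Matrix.specialUnitaryGroup (Fin 2) ℂ)) : Matrix (Fin 2) (Fin 2) ℂ).trace =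
      ((X : Matrix.specialUnitaryGroup (Fin 2) ℂ) : Matrix (Fin 2) (Fin 2) ℂ).trace := by
  rw [Submonoid.coe_mul, Submonoid.coe_mul, Matrix.trace_mul_cycle, ← Submonoid.coe_mul, inv_mul_cancel]
  simp

/-- **Chord of a conjugate of the torus**: `‖1 - R D(ψ) R⁻¹‖² = 2 - 2cos ψ`. [folklore] -/
theorem norm_one_sub_conj_torus_sq (R : Matrix.specialUnitaryGroup (Fin 2) ℂ) (ψ : ℝ) :
    ‖(1 : Matrix (Fin 2) (Fin 2) ℂ) - ((R * torus ψ * R⁻¹ : Matrix.specialUnitaryGroup (Fin 2) ℂ) : Matrix (Fin 2) (Fin 2) ℂ)‖ ^ 2 =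
      2 - 2 * Real.cos ψ := by
  rw [norm_one_sub_coe_sq, trace_conj, trace_torus_re]

/-- **From a chord bound to an angle bound**: if `‖1 - E‖ ≤ e` then `E = R D(ψ) R⁻¹` with
`0 ≤ ψ ≤ (π/2) e`. [folklore] -/
theorem exists_conj_torus_of_norm_le (E : Matrix.specialUnitaryGroup (Fin 2) ℂ) {e : ℝ}
    (he : ‖(1 : Matrix (Fin 2) (Fin 2) ℂ) - (E : Matrix (Fin 2) (Fin 2) ℂ)‖ ≤ e) :
    ∃ R : Matrix.specialUnitaryGroup (Fin 2) ℂ, ∃ ψ : ℝ, 0 ≤ ψ ∧ ψ ≤ Real.pi / 2 * e ∧ E = R * torus ψ * R⁻¹ := by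
  obtain ⟨R, ψ, h0, hπ, rfl⟩ := exists_conj_torus E
  refine ⟨R, ψ, h0, ?_, rfl⟩
  have hψ : |ψ| ≤ Real.pi := by rw [abs_of_nonneg h0]; exact hπ
  have h1 := mul_abs_le_norm_one_sub_torus hψ
  have h2 : ‖(1 : Matrix (Fin 2) (Fin 2) ℂ) - ((torus ψ : Matrix.specialUnitaryGroup (Fin 2) ℂ) : Matrix (Fin 2) (Fin 2) ℂ)‖ =
      ‖(1 : Matrix (Fin 2) (Fin 2) ℂ) - ((R * torus ψ * R⁻¹ : Matrix.specialUnitaryGroup (Fin 2) ℂ) : Matrix (Fin 2) (Fin 2) ℂ)‖ := by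
    have a := norm_one_sub_torus_sq ψ
    have b := norm_one_sub_conj_torus_sq R ψ
    have na := norm_nonneg ((1 : Matrix (Fin 2) (Fin 2) ℂ) - ((torus ψ : Matrix.specialUnitaryGroup (Fin 2) ℂ) : Matrix (Fin 2) (Fin 2) ℂ))
    have nb := norm_nonneg ((1 : Matrix (Fin 2) (Fin 2) ℂ) - ((R * torus ψ * R⁻¹ : Matrix.specialUnitaryGroup (Fin 2) ℂ) : Matrix (Fin 2) (Fin 2) ℂ))
    nlinarith
  rw [abs_of_nonneg h0] at h1
  have hpi := Real.pi_pos
  rw [h2] at h1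
  have : 2 / Real.pi * ψ ≤ e := h1.trans he
  calc ψ = Real.pi / 2 * (2 / Real.pi * ψ) := by field_simp
    _ ≤ Real.pi / 2 * e := mul_le_mul_of_nonneg_left this (by positivity)

end Torus

end Literature.Computability.QuantumComplexity

end
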